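import Mathlib
import HarnessLib.Audit
import Summits.PneNP.PneNP.Theorems.PstarCrossSystem
import Summits.PneNP.PneNP.Theorems.PstarChordBridgeKill

/-!
# The blind free CROSS gate: the OR-product on `Z`, the two (M0) witnesses, and the REGIME TRICHOTOMY of the virtual system (O2 / E1; prover-1 g22)

FRONTIER range-avoidance ladder, rung F-N3 (`stmt-PneNP-19007`), cell `pnp-ideate`; restricted-model proof complexity — nothing here bears on `P` versus `NP`.

Cross data `B` (`PstarCrossData.CrossData I r B e_p e_q g₀`), virtual system `V = (sys I B).vsys e_p e_q` on `N₁ = N.erase e_q` (`PstarCrossSystem`: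
infeasible, chord-minimal, constant reads, virtual chord `e_p` reading `(1,0)` with prescribed product `u_p ∨ u_q`).  This file:

* `orU_eq_one_of_val₂` — `x_p ∨ x_q ≡ 1` on `Z` in virtual form: an admissible virtual state meeting the second target has OR-product `1`;
* `witness_of_solution`, `exists_witness_p`, `exists_witness_q` — the (M0) witnesses of `e_p` / `e_q`: virtual states on `N₁.erase e_p` hitting the target
  with virtual bit `0` at base points with `(u_p, u_q) = (1,0)` resp. `(0,1)`;
* `read_everywhere` — every chord of `N₁` is read (M-read + constancy);
* `corner_forces` — a chord of `N₁ ∖ e_p` with a read vector off the line of `(1,0)` is never killable together with the virtual chord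
  (`PstarChordSystem.not_killable_pair`): **`u_p = 0 ∧ u_q = 0 ⟹ u_{e'} = 1`** at every base point (the CORNER FORCING);
* **`regime_trichotomy`** — pairwise killability of the REAL chords (`PstarChordBridgeKill.killable_pair`) + `U1_or_U2_of_pairwise` on `N₁ ∖ e_p`:
  EITHER (P) every read vector of `V` lies on the line of `(1,0)` — the virtual system is single-read: by (★★) every chord of `N₁` is forced ON on
  `Z(q)`, `q = F₂ + t₂`, in particular `Z(q) ⊆ {u_p ∨ u_q = 1}`; OR (T) `N₁ ∖ e_p ≠ ∅` and every chord of `N₁ ∖ e_p` is read, along ONE `m ∈ {(0,1), (1,1)}`,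
  and is corner-forced; OR (U2) `N₁ ∖ e_p = {e₀}` is a single chord with two independent reads, corner-forced.
-/

set_option linter.dupNamespace false -- `Summit.PneNP.PneNP.…`: summit = sub-problem name (D-0017 single-conjunct layout)

open Finset Literature.Computability.Complexity
open Summit.PneNP.PneNP.Theorems.PstarFibrePolys (bit bit_xor bit_and bit_injective)
open Summit.PneNP.PneNP.Theorems.PstarTyped (Typed)
open Summit.PneNP.PneNP.Theorems.PstarSALevel (varSet bdry BoundaryExpanding SimpleOverlap)
open Summit.PneNP.PneNP.Theorems.PstarGapOneAll (gval)
open Summit.PneNP.PneNP.Theorems.PstarXCore (xverts)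
open Summit.PneNP.PneNP.Theorems.PstarReadSumset (V2)
open Summit.PneNP.PneNP.Theorems.PstarChordSystem (ChordSystem)
open Summit.PneNP.PneNP.Theorems.PstarChordBridgeTools
open Summit.PneNP.PneNP.Theorems.PstarChordBridge
open Summit.PneNP.PneNP.Theorems.PstarChordBridgeKill (killable_pair)
open Summit.PneNP.PneNP.Theorems.PstarCrossData (CSolution CrossData)
open Summit.PneNP.PneNP.Theorems.PstarCrossSystem

namespace Summit.PneNP.PneNP.Theorems.PstarCrossRegime

variable {n m : ℕ}

section

variable (I : LocalMap 4 n m) {r : ℕ} {B : BridgeData n m} {e_p e_q g₀ : Fin m}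

/-! ## The OR-product on `Z` and the two witnesses -/

/-- **`x_p ∨ x_q ≡ 1` on `Z`, virtually**: an admissible virtual state meeting the second target sits at a base point with OR-product `1`. -/
theorem orU_eq_one_of_val₂ (hI : I.IsPure xorAndPred) (hT : Typed I) (hD : CrossData I r B e_p e_q g₀) {x₀ : Fin n → ZMod 2}
    {s : Fin m → ZMod 2 × ZMod 2} (hadm : ((sys I B).vsys e_p e_q).Adm (B.N.erase e_q) x₀ s)
    (hval : (((sys I B).vsys e_p e_q).val (B.N.erase e_q) x₀ s).2 = (sys I B).t.2) : (sys I B).orU e_p e_q x₀ = 1 := by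
  classical
  set V := (sys I B).vsys e_p e_q
  rcases (by decide : ∀ t : ZMod 2, t = 0 ∨ t = 1) ((sys I B).orU e_p e_q x₀) with h0 | h1
  swap
  · exact h1
  exfalso
  have hpe : e_p ∈ B.N.erase e_q := mem_erase.2 ⟨hD.ne, hD.mem_p⟩
  -- switch the virtual chord OFF: still admissible, same second value
  let s' := Function.update s e_p ((0, 0) : ZMod 2 × ZMod 2)
  have hadm' : V.Adm (B.N.erase e_q) x₀ s' := V.adm_update (V.adm_erase hadm e_p) (by rw [mul_zero, ChordSystem.vsys_u_self, h0])
  have hval' : (V.val (B.N.erase e_q) x₀ s').2 = (sys I B).t.2 := by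
    have hρ := vsys_reads_p I hD x₀
    rw [V.val_eq hpe, V.val_erase_update, V.contrib_update_self, hρ.2, smul_zero, add_zero, Prod.snd_add, Prod.smul_snd, hρ.1]
    rw [V.val_eq hpe, Prod.snd_add] at hval
    unfold ChordSystem.contrib at hval
    rw [hρ.1, hρ.2, smul_zero, add_zero, Prod.smul_snd] at hval
    simpa using hval
  obtain ⟨z, hzJ, -, h2, hp, hq⟩ := realise I hI hT hD x₀ s' hadm'
  rw [hval'] at h2
  have hs'p : (s' e_p).1 = 0 := by simp [s']
  rw [hs'p] at hp hq
  have hzp : z (I.vars e_p 2) = false := by revert hp; cases z (I.vars e_p 2) <;> simp [bit]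
  have hzq : z (I.vars e_q 2) = false := by revert hq; cases z (I.vars e_q 2) <;> simp [bit]
  rcases hD.or_on_Z z hzJ (bit_injective (by rw [h2]; rfl)) with h | h
  · rw [hzp] at h; exact Bool.noConfusion h
  · rw [hzq] at h; exact Bool.noConfusion h

/-- **The witness lemma.**  An assignment solving every output of `J₀` except possibly `e_p, e_q`, with the real constraint values on target, reads as a
virtual state on `(N.erase e_q).erase e_p` hitting the target, whose virtual bit is `0`, at a base point with OR-product `1`; and `x_p = x_q = 0` there. -/
theorem witness_of_solution (hI : I.IsPure xorAndPred) (hT : Typed I) (hD : CrossData I r B e_p e_q g₀) {z : Fin n → Bool}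
    (hz : ∀ j ∈ B.J₀, j ≠ e_p → j ≠ e_q → I.eval z j = B.y j) (hz1 : gval I B.C₁ (insert g₀ B.G₁) z = B.b₁)
    (hz2 : gval I B.C₂ B.G₂ z = B.b₂) :
    ((sys I B).vsys e_p e_q).Adm ((B.N.erase e_q).erase e_p) (fun v => bit (z v)) (vstate I B e_p e_q z) ∧
      ((sys I B).vsys e_p e_q).val (B.N.erase e_q) (fun v => bit (z v)) (vstate I B e_p e_q z) = (sys I B).t ∧
      (sys I B).orU e_p e_q (fun v => bit (z v)) = 1 ∧ z (I.vars e_p 2) = false ∧ z (I.vars e_q 2) = false := by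
  set V := (sys I B).vsys e_p e_q
  have hzF : ∀ j ∈ B.J₀ \ B.N, I.eval z j = B.y j := fun j hj =>
    hz j (mem_sdiff.1 hj).1 (fun h => (mem_sdiff.1 hj).2 (h ▸ hD.mem_p)) (fun h => (mem_sdiff.1 hj).2 (h ▸ hD.mem_q))
  have hadm : V.Adm ((B.N.erase e_q).erase e_p) (fun v => bit (z v)) (vstate I B e_p e_q z) := fun e he =>
    vadm_of_ne I hI hD hzF (mem_of_mem_erase (mem_of_mem_erase he)) (ne_of_mem_erase he)
      (hz e (hD.wf.hN (mem_of_mem_erase (mem_of_mem_erase he))) (ne_of_mem_erase he) (ne_of_mem_erase (mem_of_mem_erase he)))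
  have hval : V.val (B.N.erase e_q) (fun v => bit (z v)) (vstate I B e_p e_q z) = (sys I B).t := by
    show V.val _ _ _ = _; rw [vval_of_solution I hI hT hD hzF, hz1, hz2]; rfl
  -- the virtual chord's state is NOT admissible (infeasibility), so the OR-product is `1` and the virtual bit `0`
  have hpe : e_p ∈ B.N.erase e_q := mem_erase.2 ⟨hD.ne, hD.mem_p⟩
  have hnot : (vstate I B e_p e_q z e_p).1 * (vstate I B e_p e_q z e_p).2 ≠ V.u e_p fun v => bit (z v) := by
    intro h
    refine vsys_infeasible I hI hT hD _ _ (fun e he => ?_) hval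
    by_cases hee : e = e_p
    · subst hee; exact h
    · exact hadm e (mem_erase.2 ⟨hee, he⟩)
  rw [vstate_self, ChordSystem.vsys_u_self] at hnot
  have key : ∀ B' u : ZMod 2, B' * u ≠ u → u = 1 ∧ B' = 0 := by decide
  have hB : bit (z (I.vars e_p 2) || z (I.vars e_q 2)) = 0 ∨ bit (z (I.vars e_p 2) || z (I.vars e_q 2)) = 1 :=
    (by decide : ∀ t : ZMod 2, t = 0 ∨ t = 1) _
  obtain ⟨hu, hB0⟩ := key _ _ hnot
  have hpq : z (I.vars e_p 2) = false ∧ z (I.vars e_q 2) = false := by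
    revert hB0; cases z (I.vars e_p 2) <;> cases z (I.vars e_q 2) <;> simp [bit]
  exact ⟨hadm, hval, hu, hpq.1, hpq.2⟩

/-- **The (M0) witness of `e_p`**: a virtual state on `(N.erase e_q).erase e_p` hitting the target with virtual bit `0`, at a base point with
`u_p = 1`, `u_q = 0`. -/
theorem exists_witness_p (hI : I.IsPure xorAndPred) (hT : Typed I) (hD : CrossData I r B e_p e_q g₀) :
    ∃ (a : Fin n → ZMod 2) (s : Fin m → ZMod 2 × ZMod 2), ((sys I B).vsys e_p e_q).Adm ((B.N.erase e_q).erase e_p) a s ∧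
      ((sys I B).vsys e_p e_q).val (B.N.erase e_q) a s = (sys I B).t ∧ (s e_p).1 = 0 ∧ (sys I B).u e_p a = 1 ∧ (sys I B).u e_q a = 0 := by
  obtain ⟨z, hzK, hz1, hz2⟩ := hD.M0 e_p (hD.wf.hN hD.mem_p)
  obtain ⟨hadm, hval, hu, hp, hq⟩ := witness_of_solution I hI hT hD (fun j hj h1 _ => hzK j (mem_erase.2 ⟨h1, hj⟩)) hz1 hz2
  have hzF : ∀ j ∈ B.J₀ \ B.N, I.eval z j = B.y j := fun j hj =>
    hzK j (mem_erase.2 ⟨fun h => (mem_sdiff.1 hj).2 (h ▸ hD.mem_p), (mem_sdiff.1 hj).1⟩)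
  -- `e_q` holds at `z` with `x_q = 0`, so `u_q = 0`; hence `u_p = 1`
  have huq : (sys I B).u e_q (fun v => bit (z v)) = 0 := by
    rw [← (eval_iff_adm I hI hD.wf hzF hD.mem_q).1 (hzK e_q (mem_erase.2 ⟨hD.ne.symm, hD.wf.hN hD.mem_q⟩)), hq]; simp [bit]
  have hup : (sys I B).u e_p (fun v => bit (z v)) = 1 := by
    rcases ((sys I B).orU_eq_one_iff e_p e_q _).1 hu with h | h
    · exact h
    · rw [huq] at h; exact absurd h (by decide)
  refine ⟨_, _, hadm, hval, ?_, hup, huq⟩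
  rw [vstate_self, hp, hq]; rfl

/-- **The (M0) witness of `e_q`**: a virtual state on `(N.erase e_q).erase e_p` hitting the target with virtual bit `0`, at a base point with
`u_p = 0`, `u_q = 1`. -/
theorem exists_witness_q (hI : I.IsPure xorAndPred) (hT : Typed I) (hD : CrossData I r B e_p e_q g₀) :
    ∃ (a : Fin n → ZMod 2) (s : Fin m → ZMod 2 × ZMod 2), ((sys I B).vsys e_p e_q).Adm ((B.N.erase e_q).erase e_p) a s ∧
      ((sys I B).vsys e_p e_q).val (B.N.erase e_q) a s = (sys I B).t ∧ (s e_p).1 = 0 ∧ (sys I B).u e_p a = 0 ∧ (sys I B).u e_q a = 1 := by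
  obtain ⟨z, hzK, hz1, hz2⟩ := hD.M0 e_q (hD.wf.hN hD.mem_q)
  obtain ⟨hadm, hval, hu, hp, hq⟩ := witness_of_solution I hI hT hD (fun j hj _ h2 => hzK j (mem_erase.2 ⟨h2, hj⟩)) hz1 hz2
  have hzF : ∀ j ∈ B.J₀ \ B.N, I.eval z j = B.y j := fun j hj =>
    hzK j (mem_erase.2 ⟨fun h => (mem_sdiff.1 hj).2 (h ▸ hD.mem_q), (mem_sdiff.1 hj).1⟩)
  have hup : (sys I B).u e_p (fun v => bit (z v)) = 0 := by
    rw [← (eval_iff_adm I hI hD.wf hzF hD.mem_p).1 (hzK e_p (mem_erase.2 ⟨hD.ne, hD.wf.hN hD.mem_p⟩)), hp]; simp [bit]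
  have huq : (sys I B).u e_q (fun v => bit (z v)) = 1 := by
    rcases ((sys I B).orU_eq_one_iff e_p e_q _).1 hu with h | h
    · rw [hup] at h; exact absurd h (by decide)
    · exact h
  refine ⟨_, _, hadm, hval, ?_, hup, huq⟩
  rw [vstate_self, hp, hq]; rfl


/-! ## Reads and the corner forcing -/

/-- **Every chord of `N.erase e_q` is read, at every base point** (M-read at the witnessing base point, constancy of the reads). -/
theorem read_everywhere (hI : I.IsPure xorAndPred) (hT : Typed I) (hD : CrossData I r B e_p e_q g₀) :
    ∀ e ∈ B.N.erase e_q, ∀ a, ((sys I B).vsys e_p e_q).ρ e a ≠ 0 ∨ ((sys I B).vsys e_p e_q).ρ' e a ≠ 0 := by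
  intro e he a
  obtain ⟨a₀, -, -, -, hR⟩ :=
    ((sys I B).vsys e_p e_q).read_of_chordMinimal (vsys_infeasible I hI hT hD) he (vsys_chordMinimal I hI hT hD he)
  unfold ChordSystem.Read at hR
  rw [(vsys_const I hD e a a₀).1, (vsys_const I hD e a a₀).2]
  exact hR

/-- **Corner forcing.**  A chord `e' ≠ e_p` of `N.erase e_q` carrying a non-zero read vector OFF the line of `(1,0)` is never killable together with the virtual
chord (`not_killable_pair`): wherever `u_p = u_q = 0`, `u_{e'} = 1`. -/
theorem corner_forces (hI : I.IsPure xorAndPred) (hT : Typed I) (hD : CrossData I r B e_p e_q g₀) {e' : Fin m} (he' : e' ∈ B.N.erase e_q)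
    (hne : e' ≠ e_p) {y : V2} (hy : y = ((sys I B).vsys e_p e_q).ρ e' 0 ∨ y = ((sys I B).vsys e_p e_q).ρ' e' 0) (hy0 : y ≠ 0)
    (hy1 : y ≠ (1, 0)) : ∀ a, (sys I B).u e_p a = 0 → (sys I B).u e_q a = 0 → (sys I B).u e' a = 1 := by
  intro a hp hq
  set V := (sys I B).vsys e_p e_q
  have hpe : e_p ∈ B.N.erase e_q := mem_erase.2 ⟨hD.ne, hD.mem_p⟩
  have hK := V.not_killable_pair (vsys_infeasible I hI hT hD) (r := fun e => V.ρ e 0) (r' := fun e => V.ρ' e 0)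
    (fun e b => (vsys_const I hD e b 0).1) (fun e b => (vsys_const I hD e b 0).2) hpe he' (Ne.symm hne) (x := (1, 0)) (y := y)
    (Or.inl (vsys_reads_p I hD 0).1.symm) hy (by decide) hy0 (Ne.symm hy1) a
  have hVp : V.u e_p a = 0 := by
    show ((sys I B).vsys e_p e_q).u e_p a = 0
    rw [ChordSystem.vsys_u_self, ChordSystem.orU_eq_zero_iff]; exact ⟨hp, hq⟩
  have hVe : V.u e' a = (sys I B).u e' a := ChordSystem.vsys_u_of_ne _ _ _ hne a
  rcases (by decide : ∀ t : ZMod 2, t = 0 ∨ t = 1) ((sys I B).u e' a) with h | h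
  · exact absurd ⟨hVp, hVe.trans h⟩ hK
  · exact h

/-! ## The regime trichotomy -/

/-- The four vectors of `𝔽₂²`. -/
private theorem v2_cases (v : V2) : v = 0 ∨ v = (1, 0) ∨ v = (0, 1) ∨ v = (1, 1) := by
  obtain ⟨a, b⟩ := v
  rcases (by decide : ∀ t : ZMod 2, t = 0 ∨ t = 1) a with rfl | rfl <;>
    rcases (by decide : ∀ t : ZMod 2, t = 0 ∨ t = 1) b with rfl | rfl
  · exact Or.inl rfl
  · exact Or.inr (Or.inr (Or.inl rfl))
  · exact Or.inr (Or.inl rfl)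
  · exact Or.inr (Or.inr (Or.inr rfl))

/-- **The regime trichotomy of cross data.**  Pure typed `(r,3/2)`-expanding instance with simple overlaps.  EITHER
(P) the virtual system is single-read — then every chord of `N.erase e_q` is forced ON on `Z(q)`, `q = F₂ + t₂` (in particular `u_p ∨ u_q ≡ 1` there);
OR (T) the chords of `(N.erase e_q).erase e_p` form a non-empty family, all read, along ONE direction `m ∈ {(0,1), (1,1)}`, each corner-forced;
OR (U2) `(N.erase e_q).erase e_p = {e₀}` is one chord with two independent read vectors, corner-forced. -/
theorem regime_trichotomy (hI : I.IsPure xorAndPred) (hT : Typed I) (hS : SimpleOverlap I) (hB : BoundaryExpanding r I)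
    (hD : CrossData I r B e_p e_q g₀) :
    (((sys I B).vsys e_p e_q).SingleRead ∧
      ∀ e ∈ B.N.erase e_q, ∀ a, (((sys I B).vsys e_p e_q).F a).2 = ((sys I B).vsys e_p e_q).t.2 → ((sys I B).vsys e_p e_q).u e a = 1) ∨
    (((B.N.erase e_q).erase e_p).Nonempty ∧ ∃ mv : V2, (mv = (0, 1) ∨ mv = (1, 1)) ∧
      (∀ e ∈ (B.N.erase e_q).erase e_p,
        (((sys I B).vsys e_p e_q).ρ e 0 = 0 ∨ ((sys I B).vsys e_p e_q).ρ e 0 = mv) ∧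
        (((sys I B).vsys e_p e_q).ρ' e 0 = 0 ∨ ((sys I B).vsys e_p e_q).ρ' e 0 = mv)) ∧
      (∀ e ∈ (B.N.erase e_q).erase e_p, ((sys I B).vsys e_p e_q).ρ e 0 ≠ 0 ∨ ((sys I B).vsys e_p e_q).ρ' e 0 ≠ 0) ∧
      (∀ e ∈ (B.N.erase e_q).erase e_p, ∀ a, (sys I B).u e_p a = 0 → (sys I B).u e_q a = 0 → (sys I B).u e a = 1)) ∨
    (∃ e₀, (B.N.erase e_q).erase e_p = {e₀} ∧ ((sys I B).vsys e_p e_q).ρ e₀ 0 ≠ 0 ∧ ((sys I B).vsys e_p e_q).ρ' e₀ 0 ≠ 0 ∧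
      ((sys I B).vsys e_p e_q).ρ e₀ 0 ≠ ((sys I B).vsys e_p e_q).ρ' e₀ 0 ∧
      ∀ a, (sys I B).u e_p a = 0 → (sys I B).u e_q a = 0 → (sys I B).u e₀ a = 1) := by
  classical
  set V := (sys I B).vsys e_p e_q with hV
  set E := (B.N.erase e_q).erase e_p with hE
  have hinf : V.Infeasible (B.N.erase e_q) := vsys_infeasible I hI hT hD
  have hconst : ∀ e a a', V.ρ e a = V.ρ e a' ∧ V.ρ' e a = V.ρ' e a' := vsys_const I hD
  have hrp : ∀ a, V.ρ e_p a = (1, 0) ∧ V.ρ' e_p a = 0 := vsys_reads_p I hD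
  have hJr : B.J₀.card ≤ r := le_trans (card_le_card (subset_union_left.trans subset_union_left)) hD.rad
  have hEN : ∀ e ∈ E, e ∈ B.N.erase e_q ∧ e ≠ e_p ∧ e ≠ e_q ∧ e ∈ B.N := fun e he =>
    ⟨mem_of_mem_erase he, ne_of_mem_erase he, ne_of_mem_erase (mem_of_mem_erase he), mem_of_mem_erase (mem_of_mem_erase he)⟩
  have hread : ∀ e ∈ E, V.ρ e 0 ≠ 0 ∨ V.ρ' e 0 ≠ 0 := fun e he => read_everywhere I hI hT hD e (hEN e he).1 0
  -- pairwise: non-zero reads of two distinct real chords of `E` coincide (they are commonly killable)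
  have hP : ∀ i ∈ E, ∀ j ∈ E, i ≠ j → ∀ x y : V2, (x = V.ρ i 0 ∨ x = V.ρ' i 0) → (y = V.ρ j 0 ∨ y = V.ρ' j 0) → x ≠ 0 → y ≠ 0 → x = y := by
    intro i hi j hj hij x y hx hy hx0 hy0
    by_contra hxy
    obtain ⟨a, hai, haj⟩ := killable_pair I hI hS hB hD.wf hJr i (hEN i hi).2.2.2 j (hEN j hj).2.2.2 hij
    refine V.not_killable_pair hinf (r := fun e => V.ρ e 0) (r' := fun e => V.ρ' e 0) (fun e b => (hconst e b 0).1)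
      (fun e b => (hconst e b 0).2) (hEN i hi).1 (hEN j hj).1 hij hx hy hx0 hy0 hxy a ⟨?_, ?_⟩
    · rw [hV, ChordSystem.vsys_u_of_ne _ _ _ (hEN i hi).2.1]; exact hai
    · rw [hV, ChordSystem.vsys_u_of_ne _ _ _ (hEN j hj).2.1]; exact haj
  rcases ChordSystem.U1_or_U2_of_pairwise hP with ⟨mv, hmv⟩ | ⟨e₀, he₀, h1, h2, h3, hothers⟩
  · by_cases hPreg : ∀ e ∈ E, (V.ρ e 0 = 0 ∨ V.ρ e 0 = (1, 0)) ∧ (V.ρ' e 0 = 0 ∨ V.ρ' e 0 = (1, 0))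
    · -- regime P: single-read
      left
      have hsr : V.SingleRead := by
        intro e a
        by_cases heN : e ∈ B.N
        · by_cases hep : e = e_p
          · subst hep; rw [(hrp a).1, (hrp a).2]; exact ⟨rfl, rfl⟩
          by_cases heq : e = e_q
          · subst heq
            have h := reads_pq I hD a
            rw [hV, ChordSystem.vsys_ρ, ChordSystem.vsys_ρ', h.2.2.1, h.2.2.2]; exact ⟨rfl, rfl⟩
          · have heE : e ∈ E := mem_erase.2 ⟨hep, mem_erase.2 ⟨heq, heN⟩⟩
            rw [(hconst e a 0).1, (hconst e a 0).2]
            obtain ⟨hρ, hρ'⟩ := hPreg e heE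
            refine ⟨?_, ?_⟩
            · rcases hρ with h | h
              · rw [h]; rfl
              · rw [h]
            · rcases hρ' with h | h
              · rw [h]; rfl
              · rw [h]
        · have h := sys_ρ_of_not_mem I B heN a
          rw [hV, ChordSystem.vsys_ρ, ChordSystem.vsys_ρ', h.1, h.2]; exact ⟨rfl, rfl⟩
      exact ⟨hsr, fun e he => V.star_star hsr hconst hinf he (vsys_chordMinimal I hI hT hD he)⟩
    · -- regime T
      right; left
      push Not at hPreg
      obtain ⟨e₁, he₁, hbad⟩ := hPreg
      -- `e₁` has a read off the line of `(1,0)`; it is `mv`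
      have hmv1 : mv ≠ 0 ∧ mv ≠ (1, 0) := by
        obtain ⟨hρ, hρ'⟩ := hmv e₁ he₁
        by_cases hρ0 : V.ρ e₁ 0 = 0 ∨ V.ρ e₁ 0 = (1, 0)
        · have hρ'0 := hbad hρ0
          rcases hρ' with h | h
          · exact absurd h hρ'0.1
          · rw [← h]; exact hρ'0
        · push Not at hρ0
          rcases hρ with h | h
          · exact absurd h hρ0.1
          · rw [← h]; exact hρ0
      refine ⟨⟨e₁, he₁⟩, mv, ?_, hmv, hread, fun e he => ?_⟩
      · rcases v2_cases mv with h | h | h | h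
        · exact absurd h hmv1.1
        · exact absurd h hmv1.2
        · exact Or.inl h
        · exact Or.inr h
      · -- corner forcing: a non-zero read of `e` equals `mv`
        obtain ⟨hρ, hρ'⟩ := hmv e he
        rcases hread e he with h0 | h0
        · have hy : V.ρ e 0 = mv := hρ.resolve_left h0
          exact corner_forces I hI hT hD (hEN e he).1 (hEN e he).2.1 (y := mv) (Or.inl hy.symm) hmv1.1 hmv1.2
        · have hy : V.ρ' e 0 = mv := hρ'.resolve_left h0
          exact corner_forces I hI hT hD (hEN e he).1 (hEN e he).2.1 (y := mv) (Or.inr hy.symm) hmv1.1 hmv1.2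
  · -- regime U2
    right; right
    have hE1 : E = {e₀} := by
      refine eq_singleton_iff_unique_mem.2 ⟨he₀, fun e he => ?_⟩
      by_contra hne
      rcases hread e he with h | h
      · exact h (hothers e he hne).1
      · exact h (hothers e he hne).2
    refine ⟨e₀, hE1, h1, h2, h3, ?_⟩
    -- one of the two reads of `e₀` is off the line of `(1,0)`
    by_cases hρ1 : V.ρ e₀ 0 = (1, 0)
    · have : V.ρ' e₀ 0 ≠ (1, 0) := fun h => h3 (hρ1.trans h.symm)
      exact corner_forces I hI hT hD (hEN e₀ he₀).1 (hEN e₀ he₀).2.1 (Or.inr rfl) h2 this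
    · exact corner_forces I hI hT hD (hEN e₀ he₀).1 (hEN e₀ he₀).2.1 (Or.inl rfl) h1 hρ1

end

end Summit.PneNP.PneNP.Theorems.PstarCrossRegime
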